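import Literature.NumberTheory.DiophantineGeometry.BelyiMapSignatureTwoThreeEven
import HarnessLib

/-!
# Coverings of signature `(2, 3, 3m)` for all `m`: one Kummer layer over the tetrahedral seed

Topic: `Literature/NumberTheory/DiophantineGeometry`. Theorem-only file (no definition, no named
fact), the companion of `BelyiMapSignatureTwoThreeEven` (signatures `(2, 3, 2m)`) in the chain
attached to the named fact `AbcWave0.darmonGranville1995_thm_2` and to Pasten's Lemma 6.10
(`Literature.NumberTheory.EllipticCurves.PastenShimura2024_lemma_6_10`). It constructs EXPLICITLY, in
the tree's function-field language and in exactly the shape consumed by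
`finite_properSolutions_of_belyiMap_of_faltings` (`AbcDarmonGranvilleSignatureReduction`), a covering
of `ℙ¹` of signature `(2, 3, 3m)` over a number field for every `m ≥ 1`
(`AlgFunctionField.exists_belyiMap_signature_two_three_triple`), whence Darmon–Granville's Theorem 2
for the signatures `(2, 3, r)` with `3 ∣ r`, `r ≥ 9`, modulo Faltings' theorem ONLY
(`finite_properSolutions_signature_two_three_triple_of_faltings`,
`finite_properSolutions_signature_triple_two_three_of_faltings`), and — together with the even case —
for ALL `r ≥ 8` not prime to `6` (`finite_properSolutions_signature_r_two_three_of_faltings`). No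
Riemann existence theorem is used.

## The construction (classically: a cyclic cover of the tetrahedral quotient `ℙ¹ → ℙ¹/A₄`)

Let `K` be a field of characteristic `0` containing `s, i` with `s² = -3`, `i² = -1` (over `ℚ`: the
cyclotomic field `ℚ(ζ₁₂)`, `i = ζ₁₂³`, `s = 2ζ₁₂⁴ + 1`). Klein's tetrahedral forms
`T₁ = X⁴ + 2s X² + 1`, `T₂ = X⁴ - 2s X² + 1` satisfy `T₁³ - T₂³ = 12 s X² (X⁴ - 1)²`
(`T₁_pow_sub_T₂_pow`), and `T₁ = (X² - α)(X² - β)` with `α = -s + 2i`, `β = -s - 2i`, `αβ = 1`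
(`T₁_eq_mul`). The **tetrahedral seed** on the line `K(v)` is
`𝔤 = 1 - (T₂(v)/T₁(v))³ = 12 s v²(v⁴ - 1)²/T₁(v)³`,
the quotient map of `ℙ¹` by the tetrahedral group `A₄`, a Belyi function of degree `12` with: zeros
of order `2` (at `v = 0, ∞` and `v⁴ = 1`, the six edge midpoints), zeros of `𝔤 - 1` of order `3` (at
`T₂(v) = 0`), poles of order `3` (at `T₁(v) = 0`), and unramified over every other closed point of the
`𝔤`-line (`seedT_cases`, `seedT_elsewhere` — the latter by the tool `pullback_separable` of the
companion file with `A = T₁³ - T₂³`, `B = T₁³`, Wronskian `A'B - AB' = 24 s X (1 - X⁴) T₁² T₂²`,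
`wronskian_T`). ONE Kummer layer of degree `m`,
`F₁ = K(v)(g)`, `g^m = h = (v² - α)(v² - β)^{m-1}`,
is totally ramified above each pole (there `v(h) ∈ {1, m - 1}` is prime to `m`, the two quadratic
factors of `T₁(v)` having orders `(1, 0)` or `(0, 1)`) and unramified everywhere else (`v(h) = 0`,
or `-2m` above `v = ∞`), by Stichtenoth Prop. 3.7.3 in the two extreme cases of the tree's
`FunctionFieldRadicalLayerSignature`. Hence `𝔤 ∈ F₁` has zeros of order `2`, `𝔤 - 1` zeros of order
`3`, poles of order `3m`, and `F₁/K(𝔤)` is unramified over the other closed points; finally `K` is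
replaced by the full constant field of `F₁` (`exists_fullConstantField_of_signature`).

What is NOT here: the signatures `(2, 3, r)` with `gcd(r, 6) = 1`, whose triangle group is perfect
(no Kummer tower over a rational seed; Riemann existence theorem or modular curves needed).

## References

* H. Darmon, A. Granville, *On the equations `z^m = F(x, y)` and `A x^p + B y^q = C z^r`*, Bull. London
  Math. Soc. 27 (1995) 513–543: Theorem 2 (p. 515), Prop. 3.1 (p. 525). [DarmonGranville1995]
* H. Stichtenoth, *Algebraic Function Fields and Codes*, GTM 254, 2009: Prop. 3.7.3 (Kummer
  extensions), Thm. 3.1.11, Prop. 1.1.5, Cor. 1.1.20. [Stichtenoth2009]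
* H. Pasten, *Shimura curves and the abc conjecture*, J. Number Theory 254 (2024) 214–335
  (arXiv:1705.09251), §6.5, Lemma 6.10. [PastenShimura2024]
-/

noncomputable section

open scoped Classical Polynomial IntermediateField

namespace Literature.NumberTheory.DiophantineGeometry

open Polynomial

universe u v

namespace AlgFunctionField

/-! ### A. The tetrahedral forms `T₁ = X⁴ + 2s X² + 1`, `T₂ = X⁴ - 2s X² + 1` (`s² = -3`) -/

/-- `T₁ = X⁴ + 2s X² + 1` (local notation). -/
local notation3 "T₁(" K ", " s ")" => (X ^ 4 + C (2 * s) * X ^ 2 + 1 : Polynomial K)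

/-- `T₂ = X⁴ - 2s X² + 1` (local notation). -/
local notation3 "T₂(" K ", " s ")" => (X ^ 4 - C (2 * s) * X ^ 2 + 1 : Polynomial K)

section Forms

variable {K : Type u} [Field K]

/-- `deg T₁ = 4`. [folklore] -/
theorem natDegree_T₁ (s : K) : (T₁(K, s)).natDegree = 4 := by compute_degree!

/-- `deg T₂ = 4`. [folklore] -/
theorem natDegree_T₂ (s : K) : (T₂(K, s)).natDegree = 4 := by compute_degree!

/-- `T₁ ≠ 0`, `T₂ ≠ 0`. [folklore] -/
theorem T_ne_zero (s : K) : T₁(K, s) ≠ 0 ∧ T₂(K, s) ≠ 0 :=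
  ⟨fun h => by have := natDegree_T₁ s; rw [h, natDegree_zero] at this; exact absurd this (by norm_num),
   fun h => by have := natDegree_T₂ s; rw [h, natDegree_zero] at this; exact absurd this (by norm_num)⟩

/-- `T₁(0) = T₂(0) = 1`. [folklore] -/
theorem T_eval_zero (s : K) : (T₁(K, s)).eval 0 = 1 ∧ (T₂(K, s)).eval 0 = 1 := by
  constructor <;> simp

/-- **Klein's identity for the tetrahedral forms**: `T₁³ - T₂³ = 12 s X² (X⁴ - 1)²` (`s² = -3`).
[folklore] -/
theorem T₁_pow_sub_T₂_pow {s : K} (hs : s ^ 2 = -3) :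
    T₁(K, s) ^ 3 - T₂(K, s) ^ 3 = C s * (12 * X ^ 2 * (X ^ 4 - 1) ^ 2) := by
  have hC : (C s) ^ 2 + 3 = (0 : K[X]) := by
    rw [← map_pow, hs, map_neg, map_ofNat]; ring
  have e : (C (2 * s) : K[X]) = 2 * C s := by rw [map_mul, map_ofNat]
  rw [e]
  linear_combination (16 * C s * X ^ 6) * hC

/-- `T₁ - T₂ = 4 s X²`. [folklore] -/
theorem T₁_sub_T₂ (s : K) : T₁(K, s) - T₂(K, s) = C (4 * s) * X ^ 2 := by
  simp only [map_mul, map_ofNat]; ring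

/-- `T₁ = (X² - α)(X² - β)` with `α = -s + 2i`, `β = -s - 2i` (`s² = -3`, `i² = -1`). [folklore] -/
theorem T₁_eq_mul {s i : K} (hs : s ^ 2 = -3) (hi : i ^ 2 = -1) :
    T₁(K, s) = (X ^ 2 - C (-s + 2 * i)) * (X ^ 2 - C (-s - 2 * i)) := by
  have hC : (C s) ^ 2 + 3 = (0 : K[X]) := by rw [← map_pow, hs, map_neg, map_ofNat]; ring
  have hI : (C i) ^ 2 + 1 = (0 : K[X]) := by rw [← map_pow, hi, map_neg, map_one]; ring
  simp only [map_mul, map_ofNat, map_add, map_sub, map_neg]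
  linear_combination (-1 : K[X]) * hC + (4 : K[X]) * hI

/-- `T₂ = (X² - α')(X² - β')` with `α' = s + 2i`, `β' = s - 2i`. [folklore] -/
theorem T₂_eq_mul {s i : K} (hs : s ^ 2 = -3) (hi : i ^ 2 = -1) :
    T₂(K, s) = (X ^ 2 - C (s + 2 * i)) * (X ^ 2 - C (s - 2 * i)) := by
  have hC : (C s) ^ 2 + 3 = (0 : K[X]) := by rw [← map_pow, hs, map_neg, map_ofNat]; ring
  have hI : (C i) ^ 2 + 1 = (0 : K[X]) := by rw [← map_pow, hi, map_neg, map_one]; ring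
  simp only [map_mul, map_ofNat, map_add, map_sub]
  linear_combination (-1 : K[X]) * hC + (4 : K[X]) * hI

/-- `αβ = 1` for `α = -s + 2i`, `β = -s - 2i`, and `α'β' = 1`: none of them vanishes. [folklore] -/
theorem roots_ne_zero {s i : K} (hs : s ^ 2 = -3) (hi : i ^ 2 = -1) :
    (-s + 2 * i ≠ 0) ∧ (-s - 2 * i ≠ 0) ∧ (s + 2 * i ≠ 0) ∧ (s - 2 * i ≠ 0) := by
  have h1 : (-s + 2 * i) * (-s - 2 * i) = 1 := by linear_combination hs - 4 * hi
  have h2 : (s + 2 * i) * (s - 2 * i) = 1 := by linear_combination hs - 4 * hi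
  refine ⟨left_ne_zero_of_mul_eq_one h1, ?_, left_ne_zero_of_mul_eq_one h2, ?_⟩
  · rw [mul_comm] at h1; exact left_ne_zero_of_mul_eq_one h1
  · rw [mul_comm] at h2; exact left_ne_zero_of_mul_eq_one h2

variable [CharZero K]

/-- `s ≠ 0` and `i ≠ 0`. [folklore] -/
theorem s_ne_zero {s : K} (hs : s ^ 2 = -3) : s ≠ 0 := by
  rintro rfl; norm_num at hs

/-- A product of two coprime separable quadratics `(X² - a)(X² - b)`, `a ≠ b`, `a, b ≠ 0`, is
separable. [folklore] -/
theorem separable_quad_mul {a b : K} (ha : a ≠ 0) (hb : b ≠ 0) (hab : a ≠ b) :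
    ((X ^ 2 - C a) * (X ^ 2 - C b) : K[X]).Separable := by
  have h2 : (2 : K) ≠ 0 := two_ne_zero
  refine (separable_X_pow_sub_C a h2 ha).mul (separable_X_pow_sub_C b h2 hb) ?_
  -- `(X² - a) = (b - a) + (X² - b)` with `b - a` a unit
  have hu : IsUnit (C (b - a) : K[X]) := isUnit_C.mpr (sub_ne_zero.mpr hab.symm).isUnit
  have hu1 : IsCoprime (C (b - a)) (X ^ 2 - C b : K[X]) := by
    simpa using (isCoprime_mul_unit_left_left hu 1 (X ^ 2 - C b : K[X])).2 isCoprime_one_left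
  have h : (X ^ 2 - C a : K[X]) = C (b - a) + (X ^ 2 - C b) * 1 := by rw [map_sub]; ring
  rw [h]
  exact hu1.add_mul_left_left 1

/-- `T₁` is separable. [folklore] -/
theorem separable_T₁ {s i : K} (hs : s ^ 2 = -3) (hi : i ^ 2 = -1) : (T₁(K, s)).Separable := by
  obtain ⟨ha, hb, -, -⟩ := roots_ne_zero hs hi
  rw [T₁_eq_mul hs hi]
  refine separable_quad_mul ha hb fun h => ?_
  have : (4 : K) * i = 0 := by linear_combination h
  have hi0 : i ≠ 0 := by rintro rfl; norm_num at hi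
  exact hi0 (by simpa using this)

/-- `T₂` is separable. [folklore] -/
theorem separable_T₂ {s i : K} (hs : s ^ 2 = -3) (hi : i ^ 2 = -1) : (T₂(K, s)).Separable := by
  obtain ⟨-, -, ha, hb⟩ := roots_ne_zero hs hi
  rw [T₂_eq_mul hs hi]
  refine separable_quad_mul ha hb fun h => ?_
  have : (4 : K) * i = 0 := by linear_combination h
  have hi0 : i ≠ 0 := by rintro rfl; norm_num at hi
  exact hi0 (by simpa using this)

/-- `T₂` and `T₁` are coprime (`T₁ - T₂ = 4 s X²`, `T₂ ≡ 1 (mod X)`, `s ≠ 0`). [folklore] -/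
theorem isCoprime_T₂_T₁ {s : K} (hs0 : s ≠ 0) : IsCoprime (T₂(K, s)) (T₁(K, s)) := by
  have hX : IsCoprime (T₂(K, s)) X := by
    have h := (isCoprime_one_left (x := (X : K[X]))).add_mul_left_left (X ^ 3 - C (2 * s) * X)
    have e : (1 + X * (X ^ 3 - C (2 * s) * X) : K[X]) = T₂(K, s) := by ring
    rwa [e] at h
  have hu : IsUnit (C (4 * s) : K[X]) := isUnit_C.mpr (mul_ne_zero (by norm_num) hs0).isUnit
  have h4 : IsCoprime (T₂(K, s)) (C (4 * s)) := by
    simpa using (isCoprime_mul_unit_left_right hu (T₂(K, s)) 1).2 isCoprime_one_right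
  have h0 : IsCoprime (T₂(K, s)) (C (4 * s) * X ^ 2) := h4.mul_right hX.pow_right
  have h := h0.add_mul_left_right 1
  have e : (C (4 * s) * X ^ 2 + T₂(K, s) * 1 : K[X]) = T₁(K, s) := by
    simp only [map_mul, map_ofNat]; ring
  rwa [e] at h

omit [CharZero K] in
/-- **The Wronskian of `A = T₁³ - T₂³` and `B = T₁³`**: `A'B - AB' = 24 s X (1 - X⁴) T₁² T₂²`
(formally: `A'B - AB' = T₂³ B' - (T₂³)' B = 3 T₁² T₂² (T₂ T₁' - T₂' T₁)` and
`T₂ T₁' - T₂' T₁ = 8 s X (1 - X⁴)`). [folklore] -/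
theorem wronskian_T (s : K) :
    derivative (T₁(K, s) ^ 3 - T₂(K, s) ^ 3) * T₁(K, s) ^ 3 -
      (T₁(K, s) ^ 3 - T₂(K, s) ^ 3) * derivative (T₁(K, s) ^ 3) =
      C (24 * s) * X * (1 - X ^ 4) * T₁(K, s) ^ 2 * T₂(K, s) ^ 2 := by
  simp only [derivative_sub, derivative_pow, derivative_add, derivative_mul,
    derivative_C, derivative_one, derivative_X, Nat.cast_ofNat, map_mul, map_ofNat,
    mul_one, Nat.add_one_sub_one]
  norm_num
  ring

end Forms

/-! ### B. The tetrahedral seed `𝔤 = 1 - (T₂(v)/T₁(v))³` on the line `K(v)` -/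

/-- `𝔱₁ = T₁(v) = v⁴ + 2s v² + 1` on the line (local notation). -/
local notation3 "𝔱₁(" K ", " s ")" =>
  ((RatFunc.X : RatFunc K) ^ 4 + algebraMap K (RatFunc K) (2 * s) * (RatFunc.X : RatFunc K) ^ 2 + 1)

/-- `𝔱₂ = T₂(v) = v⁴ - 2s v² + 1` on the line (local notation). -/
local notation3 "𝔱₂(" K ", " s ")" =>
  ((RatFunc.X : RatFunc K) ^ 4 - algebraMap K (RatFunc K) (2 * s) * (RatFunc.X : RatFunc K) ^ 2 + 1)

/-- The tetrahedral seed `𝔤 = 1 - (T₂(v)/T₁(v))³ = 12 s v²(v⁴ - 1)²/T₁(v)³` (local notation). -/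
local notation3 "𝔤(" K ", " s ")" => ((1 - (𝔱₂(K, s) / 𝔱₁(K, s)) ^ 3 : RatFunc K))

/-- The quadratic factors `𝔮(K, c) = v² - c` of `T₁(v) = 𝔮(α) 𝔮(β)` (local notation). -/
local notation3 "𝔮(" K ", " c ")" => ((RatFunc.X : RatFunc K) ^ 2 - algebraMap K (RatFunc K) c)

section Seed

variable {K : Type u} [Field K]

/-- `T₁(v) = 𝔱₁`, `T₂(v) = 𝔱₂`, `(X² - c)(v) = 𝔮(c)`. [folklore] -/
theorem aeval_T (s c : K) :
    aeval (RatFunc.X : RatFunc K) T₁(K, s) = 𝔱₁(K, s) ∧ aeval (RatFunc.X : RatFunc K) T₂(K, s) = 𝔱₂(K, s) ∧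
      aeval (RatFunc.X : RatFunc K) (X ^ 2 - C c : K[X]) = 𝔮(K, c) := by
  refine ⟨?_, ?_, ?_⟩ <;> simp [aeval_C]

/-- Non-vanishing on the line: `T₁(v)`, `T₂(v)`, `v`, `v⁴ - 1`, `𝔮(c)`. [folklore] -/
theorem seedT_ne_zero (s c : K) :
    𝔱₁(K, s) ≠ 0 ∧ 𝔱₂(K, s) ≠ 0 ∧ (RatFunc.X : RatFunc K) ≠ 0 ∧ (RatFunc.X : RatFunc K) ^ 4 - 1 ≠ 0 ∧
      𝔮(K, c) ≠ 0 := by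
  obtain ⟨h1, h2⟩ := T_ne_zero (K := K) s
  obtain ⟨e1, e2, e3⟩ := aeval_T (K := K) s c
  refine ⟨e1 ▸ aeval_ratFunc_X_ne_zero h1, e2 ▸ aeval_ratFunc_X_ne_zero h2, RatFunc.X_ne_zero, ?_,
    e3 ▸ aeval_ratFunc_X_ne_zero (X_pow_sub_C_ne_zero (by norm_num) c)⟩
  have h := aeval_ratFunc_X_ne_zero (K := K) (p := X ^ 4 - 1) (by
    rw [← C_1]; exact X_pow_sub_C_ne_zero (by norm_num) 1)
  simpa using h

/-- `𝔤 = (T₁(v)³ - T₂(v)³)/T₁(v)³`. [folklore] -/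
theorem seedT_eq_div (s : K) :
    𝔤(K, s) = aeval (RatFunc.X : RatFunc K) (T₁(K, s) ^ 3 - T₂(K, s) ^ 3) /
      aeval (RatFunc.X : RatFunc K) (T₁(K, s) ^ 3) := by
  obtain ⟨h1, -, -⟩ := seedT_ne_zero (K := K) s 0
  obtain ⟨e1, e2, -⟩ := aeval_T (K := K) s 0
  rw [map_sub, map_pow, map_pow, e1, e2, sub_div, div_self (pow_ne_zero _ h1), div_pow]

/-- Closed form of the numerator: `T₁(v)³ - T₂(v)³ = 12 s v² (v⁴ - 1)²`. [folklore] -/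
theorem seedT_num_eq {s : K} (hs : s ^ 2 = -3) :
    aeval (RatFunc.X : RatFunc K) (T₁(K, s) ^ 3 - T₂(K, s) ^ 3) =
      algebraMap K (RatFunc K) s *
        (12 * (RatFunc.X : RatFunc K) ^ 2 * ((RatFunc.X : RatFunc K) ^ 4 - 1) ^ 2) := by
  rw [T₁_pow_sub_T₂_pow hs, map_mul, aeval_C, map_mul, map_mul, map_pow, map_pow, map_sub, map_pow,
    aeval_X, map_one, map_ofNat]

variable [CharZero K]

/-- The seed is non-zero: its numerator is `12 s v²(v⁴ - 1)² ≠ 0`. [folklore] -/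
theorem seedT_seed_ne_zero {s : K} (hs : s ^ 2 = -3) : 𝔤(K, s) ≠ 0 := by
  obtain ⟨ht1, -, hv0, hw0, -⟩ := seedT_ne_zero (K := K) s 0
  obtain ⟨haT1, -, -⟩ := aeval_T (K := K) s 0
  have hsK : algebraMap K (RatFunc K) s ≠ 0 := (_root_.map_ne_zero _).2 (s_ne_zero hs)
  have h12 : (12 : RatFunc K) ≠ 0 := by
    rw [← map_ofNat (algebraMap K (RatFunc K)) 12, _root_.map_ne_zero]; norm_num
  rw [seedT_eq_div, map_pow, haT1, seedT_num_eq hs]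
  exact div_ne_zero (mul_ne_zero hsK (mul_ne_zero (mul_ne_zero h12 (pow_ne_zero _ hv0))
    (pow_ne_zero _ hw0))) (pow_ne_zero _ ht1)

/-- **The five kinds of places of the line for the tetrahedral seed.** At every place `P` of
`K(v)` (with `α = -s + 2i`, `β = -s - 2i`, so `T₁ = (X² - α)(X² - β)`) one of: (∞) `v(v) < 0`,
`v(𝔤) = 2`, `v(𝔤 - 1) = 0`, `v(v² - α) = v(v² - β) = -2`; (zeros at finite distance: `v = 0` or
`v⁴ = 1`) `v(𝔤) = 2`, `v(𝔤 - 1) = 0`, `v(T₁(v)) = 0`, `v² - α`, `v² - β` units; (poles: `T₁(v) = 0`)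
`v(𝔤) = v(𝔤 - 1) = -3` and `(v(v² - α), v(v² - β)) ∈ {(1, 0), (0, 1)}`; (ones: `T₂(v) = 0`)
`v(𝔤) = 0`, `v(𝔤 - 1) = 3`, `v(T₁(v)) = 0`, `v² - α`, `v² - β` units; (generic) `v ∈ 𝒪_P`, `T₁(v)` unit,
`v(𝔤) = v(𝔤 - 1) = 0`, `v² - α`, `v² - β` units — together with `v(π₀(𝔤))` in the first four
cases. [folklore] -/
theorem seedT_cases {s i : K} (hs : s ^ 2 = -3) (hi : i ^ 2 = -1) (P : PlaceOver K (RatFunc K)) :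
    (P.ord (RatFunc.X : RatFunc K) < 0 ∧ P.ord 𝔤(K, s) = 2 ∧ P.ord (𝔤(K, s) - 1) = 0 ∧
        P.ord 𝔮(K, -s + 2 * i) = -2 ∧ P.ord 𝔮(K, -s - 2 * i) = -2 ∧
        ∀ π₀ : K[X], π₀.eval 0 ≠ 0 → P.ord (aeval 𝔤(K, s) π₀) = 0) ∨
      (P.ord 𝔤(K, s) = 2 ∧ P.ord (𝔤(K, s) - 1) = 0 ∧ P.ord 𝔱₁(K, s) = 0 ∧
        P.ord 𝔮(K, -s + 2 * i) = 0 ∧ P.ord 𝔮(K, -s - 2 * i) = 0 ∧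
        ∀ π₀ : K[X], π₀.eval 0 ≠ 0 → P.ord (aeval 𝔤(K, s) π₀) = 0) ∨
      (P.ord 𝔤(K, s) = -3 ∧ P.ord (𝔤(K, s) - 1) = -3 ∧
        ((P.ord 𝔮(K, -s + 2 * i) = 1 ∧ P.ord 𝔮(K, -s - 2 * i) = 0) ∨
          (P.ord 𝔮(K, -s + 2 * i) = 0 ∧ P.ord 𝔮(K, -s - 2 * i) = 1)) ∧
        ∀ π₀ : K[X], π₀ ≠ 0 → P.ord (aeval 𝔤(K, s) π₀) = π₀.natDegree * (-3)) ∨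
      (P.ord 𝔤(K, s) = 0 ∧ P.ord (𝔤(K, s) - 1) = 3 ∧ P.ord 𝔱₁(K, s) = 0 ∧
        P.ord 𝔮(K, -s + 2 * i) = 0 ∧ P.ord 𝔮(K, -s - 2 * i) = 0 ∧
        ∀ π₀ : K[X], π₀.eval 1 ≠ 0 → P.ord (aeval 𝔤(K, s) π₀) = 0) ∨
      ((RatFunc.X : RatFunc K) ∈ P.toValuationSubring ∧ P.ord 𝔱₁(K, s) = 0 ∧ P.ord 𝔤(K, s) = 0 ∧
        P.ord (𝔤(K, s) - 1) = 0 ∧ P.ord 𝔮(K, -s + 2 * i) = 0 ∧ P.ord 𝔮(K, -s - 2 * i) = 0) := by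
  have hut := RatFunc.transcendental_X (K := K)
  have hu1 := finrank_adjoin_ratFunc_X (K := K)
  have hs0 := s_ne_zero hs
  obtain ⟨hα0, hβ0, -, -⟩ := roots_ne_zero hs hi
  obtain ⟨ht1, ht2, hv0, hw0, hqa⟩ := seedT_ne_zero (K := K) s (-s + 2 * i)
  obtain ⟨-, -, -, -, hqb⟩ := seedT_ne_zero (K := K) s (-s - 2 * i)
  obtain ⟨hT1, hT2⟩ := T_ne_zero (K := K) s
  obtain ⟨haT1, haT2, haqa⟩ := aeval_T (K := K) s (-s + 2 * i)
  obtain ⟨-, -, haqb⟩ := aeval_T (K := K) s (-s - 2 * i)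
  -- constants
  have hsK : algebraMap K (RatFunc K) s ≠ 0 := (_root_.map_ne_zero _).2 hs0
  have h12 : (12 : RatFunc K) ≠ 0 := by
    rw [← map_ofNat (algebraMap K (RatFunc K)) 12, _root_.map_ne_zero]; norm_num
  have hord12 : P.ord (12 : RatFunc K) = 0 := by
    rw [← map_ofNat (algebraMap K (RatFunc K)) 12]; exact PlaceOver.ord_algebraMap_holds P (by norm_num)
  have hordsK : P.ord (algebraMap K (RatFunc K) s) = 0 := PlaceOver.ord_algebraMap_holds P hs0
  -- the numerator and the orders of `𝔤`, `𝔤 - 1`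
  have hnum := seedT_num_eq (K := K) hs
  have hN0 : aeval (RatFunc.X : RatFunc K) (T₁(K, s) ^ 3 - T₂(K, s) ^ 3) ≠ 0 := by
    rw [hnum]
    exact mul_ne_zero hsK (mul_ne_zero (mul_ne_zero h12 (pow_ne_zero _ hv0)) (pow_ne_zero _ hw0))
  have haB : aeval (RatFunc.X : RatFunc K) (T₁(K, s) ^ 3) = 𝔱₁(K, s) ^ 3 := by rw [map_pow, haT1]
  have hordg : P.ord 𝔤(K, s) = 2 * P.ord (RatFunc.X : RatFunc K) +
      2 * P.ord ((RatFunc.X : RatFunc K) ^ 4 - 1) - 3 * P.ord 𝔱₁(K, s) := by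
    rw [seedT_eq_div, haB, P.ord_div hN0 (pow_ne_zero _ ht1), P.ord_pow ht1, hnum,
      P.ord_mul_eq hsK (mul_ne_zero (mul_ne_zero h12 (pow_ne_zero _ hv0)) (pow_ne_zero _ hw0)),
      P.ord_mul_eq (mul_ne_zero h12 (pow_ne_zero _ hv0)) (pow_ne_zero _ hw0),
      P.ord_mul_eq h12 (pow_ne_zero _ hv0), P.ord_pow hv0, P.ord_pow hw0, hordsK, hord12]
    push_cast; ring
  have hordg1 : P.ord (𝔤(K, s) - 1) = 3 * (P.ord 𝔱₂(K, s) - P.ord 𝔱₁(K, s)) := by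
    have e : 𝔤(K, s) - 1 = -((𝔱₂(K, s) / 𝔱₁(K, s)) ^ 3) := by ring
    rw [e, P.ord_neg, P.ord_pow (div_ne_zero ht2 ht1), P.ord_div ht2 ht1]
    push_cast; ring
  -- the quadratic factors: `𝔮(α) 𝔮(β) = T₁(v)`
  have hqq : 𝔮(K, -s + 2 * i) * 𝔮(K, -s - 2 * i) = 𝔱₁(K, s) := by
    rw [← haqa, ← haqb, ← haT1, T₁_eq_mul hs hi, map_mul]
  have hordqq : P.ord 𝔮(K, -s + 2 * i) + P.ord 𝔮(K, -s - 2 * i) = P.ord 𝔱₁(K, s) := by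
    rw [← hqq, P.ord_mul_eq hqa hqb]
  have haw : aeval (RatFunc.X : RatFunc K) (X ^ 4 - 1 : K[X]) = RatFunc.X ^ 4 - 1 := by simp
  have hpw : (X ^ 4 - 1 : K[X]) ≠ 0 := by rw [← C_1]; exact X_pow_sub_C_ne_zero (by norm_num) 1
  have hdq : ∀ c : K, (X ^ 2 - C c : K[X]).natDegree = 2 := fun c => natDegree_X_pow_sub_C
  rcases lt_trichotomy (P.ord (RatFunc.X : RatFunc K)) 0 with hneg | hzero | hpos
  · -- (∞)
    left
    have hvm1 : P.ord (RatFunc.X : RatFunc K) = -1 := P.ord_eq_neg_one_of_finrank_eq_one hut hu1 hneg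
    have hot1 : P.ord 𝔱₁(K, s) = -4 := by
      rw [← haT1, (P.ord_aeval_of_ord_neg hneg hT1).2, natDegree_T₁, hvm1]; norm_num
    have hot2 : P.ord 𝔱₂(K, s) = -4 := by
      rw [← haT2, (P.ord_aeval_of_ord_neg hneg hT2).2, natDegree_T₂, hvm1]; norm_num
    have how : P.ord ((RatFunc.X : RatFunc K) ^ 4 - 1) = -4 := by
      rw [← haw, (P.ord_aeval_of_ord_neg hneg hpw).2, ← C_1, natDegree_X_pow_sub_C, hvm1]; norm_num
    have hg : P.ord 𝔤(K, s) = 2 := by rw [hordg, hvm1, how, hot1]; norm_num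
    have hqa2 : P.ord 𝔮(K, -s + 2 * i) = -2 := by
      rw [← haqa, (P.ord_aeval_of_ord_neg hneg (X_pow_sub_C_ne_zero (by norm_num) _)).2, hdq,
        hvm1]; norm_num
    have hqb2 : P.ord 𝔮(K, -s - 2 * i) = -2 := by
      rw [← haqb, (P.ord_aeval_of_ord_neg hneg (X_pow_sub_C_ne_zero (by norm_num) _)).2, hdq,
        hvm1]; norm_num
    refine ⟨hneg, hg, by rw [hordg1, hot1, hot2]; norm_num, hqa2, hqb2, fun π₀ h0 => ?_⟩
    exact (P.ord_aeval_eq_zero_of_eval_ne_zero (by rw [hg]; norm_num) h0).2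
  · -- `v ∈ 𝒪_P`, `v(v) = 0`
    have hvO : (RatFunc.X : RatFunc K) ∈ P.toValuationSubring :=
      (P.mem_toValuationSubring_iff_ord_nonneg hv0).2 hzero.ge
    have hnn1 : 0 ≤ P.ord 𝔱₁(K, s) := by rw [← haT1]; exact P.ord_nonneg_of_mem (P.aeval_mem hvO _)
    have hnn2 : 0 ≤ P.ord 𝔱₂(K, s) := by rw [← haT2]; exact P.ord_nonneg_of_mem (P.aeval_mem hvO _)
    have hnnw : 0 ≤ P.ord ((RatFunc.X : RatFunc K) ^ 4 - 1) := by
      rw [← haw]; exact P.ord_nonneg_of_mem (P.aeval_mem hvO _)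
    have hnnqa : 0 ≤ P.ord 𝔮(K, -s + 2 * i) := by
      rw [← haqa]; exact P.ord_nonneg_of_mem (P.aeval_mem hvO _)
    have hnnqb : 0 ≤ P.ord 𝔮(K, -s - 2 * i) := by
      rw [← haqb]; exact P.ord_nonneg_of_mem (P.aeval_mem hvO _)
    -- the residue `r` of `v` and the exclusions
    have hinj := (algebraMap K P.residueField).injective
    have hr0 : IsLocalRing.residue P.toValuationSubring ⟨RatFunc.X, hvO⟩ ≠ 0 := fun h => by
      have := (P.residue_eq_zero_iff_ord_pos hvO hv0).1 h; omega
    have hS : (algebraMap K P.residueField s) ^ 2 = -3 := by rw [← map_pow, hs, map_neg, map_ofNat]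
    have hSne : algebraMap K P.residueField s ≠ 0 := (_root_.map_ne_zero _).2 hs0
    have h2ne : (2 : P.residueField) ≠ 0 := by
      rw [← map_ofNat (algebraMap K P.residueField) 2]; exact (_root_.map_ne_zero _).2 two_ne_zero
    have h8ne : (8 : P.residueField) ≠ 0 := by
      rw [← map_ofNat (algebraMap K P.residueField) 8]; exact (_root_.map_ne_zero _).2 (by norm_num)
    have haT10 : aeval (RatFunc.X : RatFunc K) T₁(K, s) ≠ 0 := by rwa [haT1]
    have haT20 : aeval (RatFunc.X : RatFunc K) T₂(K, s) ≠ 0 := by rwa [haT2]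
    have hpos1 : 0 < P.ord 𝔱₁(K, s) ↔ IsLocalRing.residue P.toValuationSubring ⟨RatFunc.X, hvO⟩ ^ 4 +
        algebraMap K P.residueField (2 * s) * IsLocalRing.residue P.toValuationSubring ⟨RatFunc.X, hvO⟩ ^ 2 +
          1 = 0 := by
      rw [← haT1, P.ord_aeval_pos_iff hvO haT10]; simp
    have hpos2 : 0 < P.ord 𝔱₂(K, s) ↔ IsLocalRing.residue P.toValuationSubring ⟨RatFunc.X, hvO⟩ ^ 4 -
        algebraMap K P.residueField (2 * s) * IsLocalRing.residue P.toValuationSubring ⟨RatFunc.X, hvO⟩ ^ 2 +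
          1 = 0 := by
      rw [← haT2, P.ord_aeval_pos_iff hvO haT20]; simp
    have hposw : 0 < P.ord ((RatFunc.X : RatFunc K) ^ 4 - 1) ↔
        IsLocalRing.residue P.toValuationSubring ⟨RatFunc.X, hvO⟩ ^ 4 - 1 = 0 := by
      rw [← haw, P.ord_aeval_pos_iff hvO (by rwa [haw])]; simp
    have hex12 : ¬ (0 < P.ord 𝔱₁(K, s) ∧ 0 < P.ord 𝔱₂(K, s)) := by
      rintro ⟨h1, h2⟩
      rw [hpos1, map_mul, map_ofNat] at h1; rw [hpos2, map_mul, map_ofNat] at h2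
      have h : (2 : P.residueField) * 2 * (algebraMap K P.residueField s) *
          IsLocalRing.residue P.toValuationSubring ⟨RatFunc.X, hvO⟩ ^ 2 = 0 := by
        linear_combination h1 - h2
      simp [hSne, hr0, h2ne] at h
    have hex1w : ¬ (0 < P.ord 𝔱₁(K, s) ∧ 0 < P.ord ((RatFunc.X : RatFunc K) ^ 4 - 1)) := by
      rintro ⟨h1, h2⟩
      rw [hpos1, map_mul, map_ofNat] at h1; rw [hposw] at h2
      set S := algebraMap K P.residueField s
      set r := IsLocalRing.residue P.toValuationSubring ⟨RatFunc.X, hvO⟩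
      have h8 : (8 : P.residueField) = 0 := by
        linear_combination (-(S * r ^ 2 - 1)) * h1 + ((S * r ^ 2 - 1) - 6) * h2 + 2 * r ^ 4 * hS
      exact h8ne h8
    have hex2w : ¬ (0 < P.ord 𝔱₂(K, s) ∧ 0 < P.ord ((RatFunc.X : RatFunc K) ^ 4 - 1)) := by
      rintro ⟨h1, h2⟩
      rw [hpos2, map_mul, map_ofNat] at h1; rw [hposw] at h2
      set S := algebraMap K P.residueField s
      set r := IsLocalRing.residue P.toValuationSubring ⟨RatFunc.X, hvO⟩
      have h8 : (8 : P.residueField) = 0 := by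
        linear_combination (S * r ^ 2 + 1) * h1 + (-(S * r ^ 2 + 1) - 6) * h2 + 2 * r ^ 4 * hS
      exact h8ne h8
    rcases hnnw.lt_or_eq with hwpos | hwz
    · -- zeros above `v⁴ = 1`
      right; left
      have h1 : P.ord 𝔱₁(K, s) = 0 := by
        rcases hnn1.lt_or_eq with h | h
        · exact (hex1w ⟨h, hwpos⟩).elim
        · exact h.symm
      have h2 : P.ord 𝔱₂(K, s) = 0 := by
        rcases hnn2.lt_or_eq with h | h
        · exact (hex2w ⟨h, hwpos⟩).elim
        · exact h.symm
      have hw1 : P.ord ((RatFunc.X : RatFunc K) ^ 4 - 1) = 1 := by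
        have hsep : (X ^ 4 - 1 : K[X]).Separable := by
          rw [← C_1]; exact separable_X_pow_sub_C 1 (by norm_num) one_ne_zero
        have h := P.ord_aeval_eq_one_of_separable_of_finrank_eq_one hut hu1 hsep (by rwa [haw])
        rwa [haw] at h
      have hg : P.ord 𝔤(K, s) = 2 := by rw [hordg, hzero, hw1, h1]; norm_num
      refine ⟨hg, by rw [hordg1, h1, h2]; norm_num, h1, by omega, by omega, fun π₀ h0 => ?_⟩
      exact (P.ord_aeval_eq_zero_of_eval_ne_zero (by rw [hg]; norm_num) h0).2
    rcases hnn1.lt_or_eq with h1pos | h1z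
    · -- poles: `T₁(v) = 0`
      right; right; left
      have h2 : P.ord 𝔱₂(K, s) = 0 := by
        rcases hnn2.lt_or_eq with h | h
        · exact (hex12 ⟨h1pos, h⟩).elim
        · exact h.symm
      have h11 : P.ord 𝔱₁(K, s) = 1 := by
        rw [← haT1]
        exact P.ord_aeval_eq_one_of_separable_of_finrank_eq_one hut hu1 (separable_T₁ hs hi)
          (by rwa [haT1])
      have hg : P.ord 𝔤(K, s) = -3 := by rw [hordg, hzero, ← hwz, h11]; norm_num
      refine ⟨hg, by rw [hordg1, h11, h2]; norm_num, by omega, fun π₀ hπ => ?_⟩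
      rw [(P.ord_aeval_of_ord_neg (by rw [hg]; norm_num) hπ).2, hg]
    rcases hnn2.lt_or_eq with h2pos | h2z
    · -- ones: `T₂(v) = 0`
      right; right; right; left
      have h21 : P.ord 𝔱₂(K, s) = 1 := by
        rw [← haT2]
        exact P.ord_aeval_eq_one_of_separable_of_finrank_eq_one hut hu1 (separable_T₂ hs hi)
          (by rwa [haT2])
      have hg1 : P.ord (𝔤(K, s) - 1) = 3 := by rw [hordg1, h21, ← h1z]; norm_num
      refine ⟨by rw [hordg, hzero, ← hwz, ← h1z]; norm_num, hg1, h1z.symm, by omega, by omega,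
        fun π₀ h1 => ?_⟩
      exact ord_aeval_eq_zero_of_ord_sub_one_pos P (by rw [hg1]; norm_num) h1
    · -- generic
      right; right; right; right
      exact ⟨hvO, h1z.symm, by rw [hordg, hzero, ← hwz, ← h1z]; norm_num,
        by rw [hordg1, ← h1z, ← h2z]; norm_num, by omega, by omega⟩
  · -- `v = 0`: a zero at finite distance
    right; left
    have hv1 : P.ord (RatFunc.X : RatFunc K) = 1 := P.ord_eq_one_of_finrank_eq_one hut hu1 hpos
    obtain ⟨he1, he2⟩ := T_eval_zero (K := K) s
    have h1 : P.ord 𝔱₁(K, s) = 0 := by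
      rw [← haT1]
      exact (P.ord_aeval_eq_zero_of_eval_ne_zero hpos (p := T₁(K, s)) (by rw [he1]; exact one_ne_zero)).2
    have h2 : P.ord 𝔱₂(K, s) = 0 := by
      rw [← haT2]
      exact (P.ord_aeval_eq_zero_of_eval_ne_zero hpos (p := T₂(K, s)) (by rw [he2]; exact one_ne_zero)).2
    have hw : P.ord ((RatFunc.X : RatFunc K) ^ 4 - 1) = 0 := by
      rw [← haw]; exact (P.ord_aeval_eq_zero_of_eval_ne_zero hpos (p := X ^ 4 - 1) (by simp)).2
    have hqa0 : P.ord 𝔮(K, -s + 2 * i) = 0 := by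
      rw [← haqa]
      exact (P.ord_aeval_eq_zero_of_eval_ne_zero hpos (p := X ^ 2 - C (-s + 2 * i))
        (by rw [eval_sub, eval_pow, eval_X, eval_C, zero_pow two_ne_zero, zero_sub]
            exact neg_ne_zero.mpr hα0)).2
    have hqb0 : P.ord 𝔮(K, -s - 2 * i) = 0 := by
      rw [← haqb]
      exact (P.ord_aeval_eq_zero_of_eval_ne_zero hpos (p := X ^ 2 - C (-s - 2 * i))
        (by rw [eval_sub, eval_pow, eval_X, eval_C, zero_pow two_ne_zero, zero_sub]
            exact neg_ne_zero.mpr hβ0)).2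
    have hg : P.ord 𝔤(K, s) = 2 := by rw [hordg, hv1, hw, h1]; norm_num
    refine ⟨hg, by rw [hordg1, h1, h2]; norm_num, h1, hqa0, hqb0, fun π₀ h0 => ?_⟩
    exact (P.ord_aeval_eq_zero_of_eval_ne_zero (by rw [hg]; norm_num) h0).2

/-- **The seed has a pole**, hence is transcendental over `K`. [cite: Stichtenoth2009, Prop. 1.1.5(c), Cor. 1.1.20] -/
theorem seedT_transcendental {s i : K} (hs : s ^ 2 = -3) (hi : i ^ 2 = -1) :
    Transcendental K 𝔤(K, s) := by
  have hut := RatFunc.transcendental_X (K := K)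
  obtain ⟨hT1, -⟩ := T_ne_zero (K := K) s
  obtain ⟨ht1, -, -, -, -⟩ := seedT_ne_zero (K := K) s 0
  obtain ⟨haT1, -, -⟩ := aeval_T (K := K) s 0
  have htr : Transcendental K (aeval (RatFunc.X : RatFunc K) T₁(K, s)) :=
    hut.aeval _ (by rw [natDegree_T₁]; norm_num) (mem_nonZeroDivisors_of_ne_zero (leadingCoeff_ne_zero.mpr hT1))
  obtain ⟨P, hP⟩ := exists_ord_pos_of_transcendental htr
  rw [haT1] at hP
  have hg0 : 𝔤(K, s) ≠ 0 := seedT_seed_ne_zero hs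
  have hpole : P.ord 𝔤(K, s) < 0 := by
    rcases seedT_cases hs hi P with ⟨hneg, -⟩ | ⟨-, -, h1, -⟩ | ⟨hg, -⟩ | ⟨-, -, h1, -⟩ | ⟨-, h1, -⟩
    · have h := (P.ord_aeval_of_ord_neg hneg hT1).2
      rw [haT1, natDegree_T₁] at h
      rw [h] at hP
      have : (0 : ℤ) ≤ 4 * P.ord (RatFunc.X : RatFunc K) := hP.le
      omega
    · omega
    · rw [hg]; norm_num
    · omega
    · omega
  intro halg
  have hmem := IsAlgFunctionField.mem_valuationSubring_of_isAlgebraic P.toValuationSubring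
    P.algebraMap_mem halg
  have := (P.mem_toValuationSubring_iff_ord_nonneg hg0).1 hmem
  omega

/-- The seed is not annihilated by a non-zero polynomial. [folklore] -/
theorem aeval_seedT_ne_zero {s i : K} (hs : s ^ 2 = -3) (hi : i ^ 2 = -1) {π₀ : K[X]} (hπ : π₀ ≠ 0) :
    aeval 𝔤(K, s) π₀ ≠ 0 :=
  fun h => seedT_transcendental (K := K) hs hi ⟨π₀, hπ, h⟩

/-- **The other closed points are unramified for the tetrahedral seed.** For `π₀` monic irreducible,
`π₀ ∉ {X, X - 1}`, at every zero `P` of `π₀(𝔤)` on the line: `v_P(π₀(𝔤)) = 1`, and `v² - α`,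
`v² - β` are units. The place is generic (`seedT_cases`), and there `v_P(π₀(𝔤)) = v_P(Ñ(v))` for the
homogenised pull-back of `π₀` under `A/B = (T₁³ - T₂³)/T₁³`, separable by `pullback_separable`: `A`, `B`
are coprime and the Wronskian is `24 s X (1 - X⁴) T₁² T₂²` (`wronskian_T`). [folklore] -/
theorem seedT_elsewhere {s i : K} (hs : s ^ 2 = -3) (hi : i ^ 2 = -1) {π₀ : K[X]} (hπi : Irreducible π₀)
    (hπm : π₀.Monic) (hπX : π₀ ≠ X) (hπX1 : π₀ ≠ X - 1) (P : PlaceOver K (RatFunc K))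
    (hP : 0 < P.ord (aeval 𝔤(K, s) π₀)) :
    P.ord (aeval 𝔤(K, s) π₀) = 1 ∧ P.ord 𝔮(K, -s + 2 * i) = 0 ∧ P.ord 𝔮(K, -s - 2 * i) = 0 := by
  have hut := RatFunc.transcendental_X (K := K)
  have hu1 := finrank_adjoin_ratFunc_X (K := K)
  have hs0 := s_ne_zero hs
  have h0 : π₀.eval 0 ≠ 0 := fun h0 => hπX (by
    have h := PlaceOver.eq_X_sub_C_of_irreducible_of_eval_eq_zero hπi hπm h0
    rwa [map_zero, sub_zero] at h)
  have h1 : π₀.eval 1 ≠ 0 := fun h1 => hπX1 (by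
    have h := PlaceOver.eq_X_sub_C_of_irreducible_of_eval_eq_zero hπi hπm h1
    rwa [map_one] at h)
  rcases seedT_cases hs hi P with ⟨-, -, -, -, -, h⟩ | ⟨-, -, -, -, -, h⟩ | ⟨-, -, -, h⟩ |
    ⟨-, -, -, -, -, h⟩ | ⟨-, hT, -, -, hqa, hqb⟩
  · rw [h π₀ h0] at hP; exact (lt_irrefl _ hP).elim
  · rw [h π₀ h0] at hP; exact (lt_irrefl _ hP).elim
  · rw [h π₀ hπi.ne_zero] at hP
    have : (0 : ℤ) ≤ π₀.natDegree := by positivity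
    nlinarith
  · rw [h π₀ h1] at hP; exact (lt_irrefl _ hP).elim
  refine ⟨?_, hqa, hqb⟩
  obtain ⟨ht1, -, -, -, -⟩ := seedT_ne_zero (K := K) s 0
  obtain ⟨haT1, -, -⟩ := aeval_T (K := K) s 0
  -- the homogenised pull-back of `π₀` under `A/B`
  set A : K[X] := T₁(K, s) ^ 3 - T₂(K, s) ^ 3 with hA
  set B : K[X] := T₁(K, s) ^ 3 with hB
  set N : K[X] := ∑ j ∈ Finset.range (π₀.natDegree + 1),
    C (π₀.coeff j) * A ^ j * B ^ (π₀.natDegree - j) with hN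
  have haB : aeval (RatFunc.X : RatFunc K) B = 𝔱₁(K, s) ^ 3 := by rw [hB, map_pow, haT1]
  have haB0 : aeval (RatFunc.X : RatFunc K) B ≠ 0 := by rw [haB]; exact pow_ne_zero _ ht1
  have hNf : aeval (RatFunc.X : RatFunc K) N = aeval (RatFunc.X : RatFunc K) B ^ π₀.natDegree *
      aeval 𝔤(K, s) π₀ := by
    rw [hN, aeval_pullback_eq π₀ A B haB0, ← seedT_eq_div]
  have hπf0 : aeval 𝔤(K, s) π₀ ≠ 0 := aeval_seedT_ne_zero hs hi hπi.ne_zero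
  have hN0 : N ≠ 0 := by
    intro h
    rw [h, map_zero] at hNf
    exact mul_ne_zero (pow_ne_zero _ haB0) hπf0 hNf.symm
  -- coprimality and the Wronskian
  have hcop : IsCoprime A B := by
    have h := ((isCoprime_T₂_T₁ (K := K) hs0).pow (m := 3) (n := 3)).neg_left.add_mul_left_left 1
    have e : (-(T₂(K, s) ^ 3) + T₁(K, s) ^ 3 * 1 : K[X]) = A := by rw [hA]; ring
    rwa [e] at h
  have hW : ∀ ρ : K[X], Irreducible ρ → ρ ∣ derivative A * B - A * derivative B →
      ρ ∣ A ∨ ρ ∣ B ∨ ρ ∣ A - B := by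
    intro ρ hρ hdvd
    rw [hA, hB, wronskian_T] at hdvd
    have hp := hρ.prime
    have hAX : A = C s * (12 * X ^ 2 * (X ^ 4 - 1) ^ 2) := by rw [hA, T₁_pow_sub_T₂_pow hs]
    rcases hp.dvd_or_dvd hdvd with h | h
    · rcases hp.dvd_or_dvd h with h | h
      · rcases hp.dvd_or_dvd h with h | h
        · rcases hp.dvd_or_dvd h with h | h
          · exact (hρ.not_isUnit (isUnit_of_dvd_unit h
              (isUnit_C.mpr (mul_ne_zero (by norm_num) hs0).isUnit))).elim
          · left; rw [hAX]
            exact dvd_mul_of_dvd_right (dvd_mul_of_dvd_left (dvd_mul_of_dvd_right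
              (h.trans (dvd_pow_self X two_ne_zero)) _) _) _
        · left; rw [hAX]
          have h' : ρ ∣ (X ^ 4 - 1 : K[X]) := by
            rw [show (X ^ 4 - 1 : K[X]) = -(1 - X ^ 4) by ring]; exact h.trans (dvd_neg.mpr dvd_rfl)
          exact dvd_mul_of_dvd_right (dvd_mul_of_dvd_right (h'.trans (dvd_pow_self _ two_ne_zero)) _) _
      · right; left; rw [hB]
        exact (hp.dvd_of_dvd_pow h).trans (dvd_pow_self _ three_ne_zero)
    · right; right
      have e : A - B = -(T₂(K, s) ^ 3) := by rw [hA, hB]; ring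
      rw [e, dvd_neg]
      exact (hp.dvd_of_dvd_pow h).trans (dvd_pow_self _ three_ne_zero)
  have hsep : N.Separable := pullback_separable hπi hπm hπX hπX1 hcop hW hN0
  have hordB : P.ord (aeval (RatFunc.X : RatFunc K) B) = 0 := by rw [haB, P.ord_pow ht1, hT, mul_zero]
  have hordN : P.ord (aeval (RatFunc.X : RatFunc K) N) = P.ord (aeval 𝔤(K, s) π₀) := by
    rw [hNf, P.ord_mul_eq (pow_ne_zero _ haB0) hπf0, P.ord_pow haB0, hordB, mul_zero, zero_add]
  have h := P.ord_aeval_eq_one_of_separable_of_finrank_eq_one hut hu1 hsep (by rw [hordN]; exact hP)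
  rwa [hordN] at h

/-- **The radicand `h = (v² - α)(v² - β)^{m-1}` of the Kummer layer**: its order is `m`-divisible at
the zeros of `𝔤` (where `v(𝔤) = 2`). [folklore] -/
theorem seedT_zeros {s i : K} (hs : s ^ 2 = -3) (hi : i ^ 2 = -1) (m : ℕ) (hm : 0 < m)
    (P : PlaceOver K (RatFunc K)) (hP : 0 < P.ord 𝔤(K, s)) :
    P.ord 𝔤(K, s) = 2 ∧
      (m : ℤ) ∣ P.ord (𝔮(K, -s + 2 * i) * 𝔮(K, -s - 2 * i) ^ (m - 1)) := by
  obtain ⟨-, -, -, -, hqa⟩ := seedT_ne_zero (K := K) s (-s + 2 * i)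
  obtain ⟨-, -, -, -, hqb⟩ := seedT_ne_zero (K := K) s (-s - 2 * i)
  have hm1 : ((m - 1 : ℕ) : ℤ) = m - 1 := by rw [Nat.cast_sub hm]; simp
  rw [P.ord_mul_eq hqa (pow_ne_zero _ hqb), P.ord_pow hqb, hm1]
  rcases seedT_cases hs hi P with ⟨-, hg, -, ha, hb, -⟩ | ⟨hg, -, -, ha, hb, -⟩ | ⟨hg, -⟩ | ⟨hg, -⟩ |
    ⟨-, -, hg, -⟩
  · exact ⟨hg, by rw [ha, hb]; exact ⟨-2, by ring⟩⟩
  · exact ⟨hg, by rw [ha, hb]; simp⟩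
  · omega
  · omega
  · omega

/-- The radicand is a unit at the zeros of `𝔤 - 1` (where `v(𝔤 - 1) = 3`). [folklore] -/
theorem seedT_ones {s i : K} (hs : s ^ 2 = -3) (hi : i ^ 2 = -1) (m : ℕ) (hm : 0 < m)
    (P : PlaceOver K (RatFunc K)) (hP : 0 < P.ord (𝔤(K, s) - 1)) :
    P.ord (𝔤(K, s) - 1) = 3 ∧
      (m : ℤ) ∣ P.ord (𝔮(K, -s + 2 * i) * 𝔮(K, -s - 2 * i) ^ (m - 1)) := by
  obtain ⟨-, -, -, -, hqa⟩ := seedT_ne_zero (K := K) s (-s + 2 * i)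
  obtain ⟨-, -, -, -, hqb⟩ := seedT_ne_zero (K := K) s (-s - 2 * i)
  have hm1 : ((m - 1 : ℕ) : ℤ) = m - 1 := by rw [Nat.cast_sub hm]; simp
  rw [P.ord_mul_eq hqa (pow_ne_zero _ hqb), P.ord_pow hqb, hm1]
  rcases seedT_cases hs hi P with ⟨-, -, hg, -⟩ | ⟨-, hg, -⟩ | ⟨-, hg, -⟩ | ⟨-, hg, -, ha, hb, -⟩ |
    ⟨-, -, -, hg, -⟩
  · omega
  · omega
  · omega
  · exact ⟨hg, by rw [ha, hb]; simp⟩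
  · omega

/-- At the poles of `𝔤` (`v(𝔤) = -3`) the order of the radicand is `1` or `m - 1`, prime to `m`.
[folklore] -/
theorem seedT_poles {s i : K} (hs : s ^ 2 = -3) (hi : i ^ 2 = -1) (m : ℕ) (hm : 0 < m)
    (P : PlaceOver K (RatFunc K)) (hP : P.ord 𝔤(K, s) < 0) :
    P.ord 𝔤(K, s) = -3 ∧
      IsCoprime (P.ord (𝔮(K, -s + 2 * i) * 𝔮(K, -s - 2 * i) ^ (m - 1))) (m : ℤ) := by
  obtain ⟨-, -, -, -, hqa⟩ := seedT_ne_zero (K := K) s (-s + 2 * i)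
  obtain ⟨-, -, -, -, hqb⟩ := seedT_ne_zero (K := K) s (-s - 2 * i)
  have hm1 : ((m - 1 : ℕ) : ℤ) = m - 1 := by rw [Nat.cast_sub hm]; simp
  rw [P.ord_mul_eq hqa (pow_ne_zero _ hqb), P.ord_pow hqb, hm1]
  rcases seedT_cases hs hi P with ⟨-, hg, -⟩ | ⟨hg, -⟩ | ⟨hg, -, hab, -⟩ | ⟨hg, -⟩ | ⟨-, -, hg, -⟩
  · omega
  · omega
  · refine ⟨hg, ?_⟩
    rcases hab with ⟨ha, hb⟩ | ⟨ha, hb⟩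
    · rw [ha, hb]; simpa using isCoprime_one_left
    · rw [ha, hb]; ring_nf; exact ⟨-1, 1, by ring⟩
  · omega
  · omega

/-- At the other closed points the radicand is a unit. [folklore] -/
theorem seedT_elsewhere_dvd {s i : K} (hs : s ^ 2 = -3) (hi : i ^ 2 = -1) (m : ℕ) {π₀ : K[X]}
    (hπi : Irreducible π₀) (hπm : π₀.Monic) (hπX : π₀ ≠ X) (hπX1 : π₀ ≠ X - 1)
    (P : PlaceOver K (RatFunc K)) (hP : 0 < P.ord (aeval 𝔤(K, s) π₀)) :
    P.ord (aeval 𝔤(K, s) π₀) = 1 ∧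
      (m : ℤ) ∣ P.ord (𝔮(K, -s + 2 * i) * 𝔮(K, -s - 2 * i) ^ (m - 1)) := by
  obtain ⟨-, -, -, -, hqa⟩ := seedT_ne_zero (K := K) s (-s + 2 * i)
  obtain ⟨-, -, -, -, hqb⟩ := seedT_ne_zero (K := K) s (-s - 2 * i)
  obtain ⟨h1, ha, hb⟩ := seedT_elsewhere hs hi hπi hπm hπX hπX1 P hP
  refine ⟨h1, ?_⟩
  rw [P.ord_mul_eq hqa (pow_ne_zero _ hqb), P.ord_pow hqb, ha, hb]
  simp

end Seed

/-! ### C. One Kummer layer: the covering of signature `(2, 3, 3m)` -/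

section Cover

/-- **One Kummer layer over the tetrahedral seed: a covering of signature `(2, 3, 3m)`** over (the
full constant field inside `F₁` of) any number field `K` containing `s, i` with `s² = -3`, `i² = -1`:
`F₁ = K(v)(g)`, `g^m = (v² - α)(v² - β)^{m-1}` (`α = -s + 2i`, `β = -s - 2i`, `T₁ = (X² - α)(X² - β)`),
and `f = 1 - (T₂(v)/T₁(v))³`. [cite: Stichtenoth2009, Prop. 3.7.3]
[cite: DarmonGranville1995, Prop. 3.1 (p. 525), signature `(2, 3, 3m)`] -/
theorem exists_belyiMap_signature_two_three_triple_aux (K : Type u) [Field K] [NumberField K]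
    {m : ℕ} (hm : 0 < m) {s i : K} (hs : s ^ 2 = -3) (hi : i ^ 2 = -1) :
    ∃ (K' : Type u) (_ : Field K') (_ : NumberField K') (F : Type u) (_ : Field F) (_ : Algebra K' F)
      (_ : IsAlgFunctionField K' F) (_ : IsIntegrallyClosedIn K' F) (f : F),
      f ∉ Set.range (algebraMap K' F) ∧
      (∀ P : PlaceOver K' F, 0 < P.ord f → P.ord f = 2) ∧
      (∀ P : PlaceOver K' F, 0 < P.ord (f - 1) → P.ord (f - 1) = 3) ∧
      (∀ P : PlaceOver K' F, P.ord f < 0 → P.ord f = -((3 * m : ℕ) : ℤ)) ∧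
      (∀ π₀ : K'[X], Irreducible π₀ → π₀.Monic → π₀ ≠ X → π₀ ≠ X - 1 →
        ∀ P : PlaceOver K' F, 0 < P.ord (aeval f π₀) → P.ord (aeval f π₀) = 1) := by
  haveI : CharZero (RatFunc K) :=
    charZero_of_injective_algebraMap (algebraMap K (RatFunc K)).injective
  have hmK : (m : K) ≠ 0 := Nat.cast_ne_zero.2 hm.ne'
  obtain ⟨-, -, -, -, hqa⟩ := seedT_ne_zero (K := K) s (-s + 2 * i)
  obtain ⟨-, -, -, -, hqb⟩ := seedT_ne_zero (K := K) s (-s - 2 * i)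
  have hH0 : (𝔮(K, -s + 2 * i) * 𝔮(K, -s - 2 * i) ^ (m - 1) : RatFunc K) ≠ 0 :=
    mul_ne_zero hqa (pow_ne_zero _ hqb)
  -- the Kummer layer
  obtain ⟨F₁, _, _, _, _, _, _, g, hg, hgen⟩ := exists_radical_extension (K := K) (F := RatFunc K)
    (𝔮(K, -s + 2 * i) * 𝔮(K, -s - 2 * i) ^ (m - 1)) hm
  haveI hAF₁ : IsAlgFunctionField K F₁ :=
    isAlgFunctionField_of_finiteDimensional (K := K) (F := RatFunc K)
  set f : F₁ := algebraMap (RatFunc K) F₁ 𝔤(K, s) with hf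
  have hft : Transcendental K f :=
    (transcendental_algebraMap_iff (algebraMap (RatFunc K) F₁).injective).2 (seedT_transcendental hs hi)
  have h₀ : ∀ R : PlaceOver K F₁, 0 < R.ord f → R.ord f = 2 := fun R hR =>
    PlaceOver.ord_algebraMap_eq_of_forall_ord_pos_of_dvd (K := K) (F := RatFunc K) (F' := F₁) hm hmK
      hH0 hg hgen (fun Q hQ => seedT_zeros hs hi m hm Q hQ) R hR
  have hi' : ∀ R : PlaceOver K F₁, R.ord f < 0 → R.ord f = -((3 * m : ℕ) : ℤ) := fun R hR => by
    have h := PlaceOver.ord_algebraMap_eq_of_forall_ord_neg_of_isCoprime (K := K) (F := RatFunc K)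
      (F' := F₁) hm hH0 hg hgen (p₀ := 3) (fun Q hQ => seedT_poles hs hi m hm Q hQ) R hR
    rw [h]; push_cast; ring
  have h₁ : ∀ R : PlaceOver K F₁, 0 < R.ord (f - 1) → R.ord (f - 1) = 3 := by
    intro R hR
    have heq : f - 1 = algebraMap (RatFunc K) F₁ (𝔤(K, s) - 1) := by
      simp only [hf, map_sub, map_one]
    rw [heq] at hR ⊢
    exact PlaceOver.ord_algebraMap_eq_of_forall_ord_pos_of_dvd (K := K) (F := RatFunc K) (F' := F₁) hm
      hmK hH0 hg hgen (fun Q hQ => seedT_ones hs hi m hm Q hQ) R hR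
  have hunr : ∀ π₀ : K[X], Irreducible π₀ → π₀.Monic → π₀ ≠ X → π₀ ≠ X - 1 →
      ∀ R : PlaceOver K F₁, 0 < R.ord (aeval f π₀) → R.ord (aeval f π₀) = 1 := by
    intro π₀ hπi hπm hX hX1 R hR
    have heq : aeval f π₀ = algebraMap (RatFunc K) F₁ (aeval 𝔤(K, s) π₀) := by
      rw [hf, aeval_algebraMap_apply]
    rw [heq] at hR ⊢
    exact PlaceOver.ord_algebraMap_eq_of_forall_ord_pos_of_dvd (K := K) (F := RatFunc K) (F' := F₁) hm
      hmK hH0 hg hgen (fun Q hQ => seedT_elsewhere_dvd hs hi m hπi hπm hX hX1 Q hQ) R hR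
  obtain ⟨K', _, _, _, _, _, hfK', h₀', h₁', hi'', hunr'⟩ :=
    exists_fullConstantField_of_signature (K := K) (F := F₁) hft h₀ h₁ hi' hunr
  exact ⟨K', inferInstance, inferInstance, F₁, inferInstance, inferInstance, inferInstance,
    inferInstance, f, hfK', h₀', h₁', hi'', hunr'⟩

/-- **A covering of signature `(2, 3, 3m)` over a number field, for every `m ≥ 1`**, in the shape of
the covering input of `finite_properSolutions_of_belyiMap_of_faltings`: the construction over the
cyclotomic field `ℚ(ζ₁₂) = ℚ(i, √-3)` (`i = ζ³`, `√-3 = 2ζ⁴ + 1`). [cite: Stichtenoth2009, Prop. 3.7.3]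
[cite: DarmonGranville1995, Prop. 3.1 (p. 525), signature `(2, 3, 3m)`] -/
theorem exists_belyiMap_signature_two_three_triple {m : ℕ} (hm : 0 < m) :
    ∃ (K : Type) (_ : Field K) (_ : NumberField K) (F : Type) (_ : Field F) (_ : Algebra K F)
      (_ : IsAlgFunctionField K F) (_ : IsIntegrallyClosedIn K F) (f : F),
      f ∉ Set.range (algebraMap K F) ∧
      (∀ P : PlaceOver K F, 0 < P.ord f → P.ord f = 2) ∧
      (∀ P : PlaceOver K F, 0 < P.ord (f - 1) → P.ord (f - 1) = 3) ∧
      (∀ P : PlaceOver K F, P.ord f < 0 → P.ord f = -((3 * m : ℕ) : ℤ)) ∧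
      (∀ π₀ : K[X], Irreducible π₀ → π₀.Monic → π₀ ≠ X → π₀ ≠ X - 1 →
        ∀ P : PlaceOver K F, 0 < P.ord (aeval f π₀) → P.ord (aeval f π₀) = 1) := by
  haveI : NeZero (12 : ℕ) := ⟨by norm_num⟩
  obtain ⟨ζ, hζ⟩ := @IsCyclotomicExtension.exists_isPrimitiveRoot {12} ℚ (CyclotomicField 12 ℚ) _ _ _
    (CyclotomicField.isCyclotomicExtension 12 ℚ) 12 (Set.mem_singleton 12) (NeZero.ne 12)
  have h12 : ζ ^ 12 = 1 := hζ.pow_eq_one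
  have h6 : ζ ^ 6 ≠ 1 := hζ.pow_ne_one_of_pos_of_lt (by norm_num) (by norm_num)
  have h4 : ζ ^ 4 ≠ 1 := hζ.pow_ne_one_of_pos_of_lt (by norm_num) (by norm_num)
  -- `i = ζ³`
  have hi : (ζ ^ 3) ^ 2 = -1 := by
    have hsq : ζ ^ 6 * ζ ^ 6 = 1 := by rw [← pow_add]; exact h12
    rcases mul_self_eq_one_iff.mp hsq with h | h
    · exact (h6 h).elim
    · rw [← pow_mul]; exact h
  -- `s = 2ζ⁴ + 1`, `ζ⁴` a primitive cube root of unity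
  have hω : (ζ ^ 4) ^ 2 + ζ ^ 4 + 1 = 0 := by
    have h3 : (ζ ^ 4) ^ 3 = 1 := by rw [← pow_mul]; exact h12
    have h : (ζ ^ 4 - 1) * ((ζ ^ 4) ^ 2 + ζ ^ 4 + 1) = 0 := by linear_combination h3
    exact (mul_eq_zero.mp h).resolve_left (sub_ne_zero.mpr h4)
  have hs : (2 * ζ ^ 4 + 1) ^ 2 = -3 := by linear_combination 4 * hω
  exact exists_belyiMap_signature_two_three_triple_aux (CyclotomicField 12 ℚ) hm hs hi

end Cover

end AlgFunctionField

/-! ### D. Darmon–Granville for the signatures `(2, 3, r)`, `3 ∣ r ≥ 9`, and all `r ≥ 8` not prime to `6`, modulo Faltings -/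

section DarmonGranville

open AlgFunctionField

/-- **`A x² + B y³ = C z^{3m}` has finitely many proper solutions for `m ≥ 3`, modulo Faltings'
theorem** (`finite_ratPlaces_of_two_le_genus`): the covering `exists_belyiMap_signature_two_three_triple`
fed into `finite_properSolutions_of_belyiMap_of_faltings`; `(2, 3, 3m)` is hyperbolic iff `m ≥ 3`.
No Riemann existence theorem is used. [cite: DarmonGranville1995, Theorem 2 (p. 515)] -/
theorem finite_properSolutions_signature_two_three_triple_of_faltings {m : ℕ} (hm : 3 ≤ m)
    (hFaltings : ∀ (K' : Type) [Field K'] (F' : Type) [Field F'] [Algebra K' F'],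
      finite_ratPlaces_of_two_le_genus K' F')
    {A B C : ℤ} (hA : A ≠ 0) (hB : B ≠ 0) (hC : C ≠ 0) :
    {t : ℤ × ℤ × ℤ | ({t.1, t.2.1, t.2.2} : Finset ℤ).gcd id = 1 ∧
      A * t.1 ^ 2 + B * t.2.1 ^ 3 = C * t.2.2 ^ (3 * m)}.Finite := by
  obtain ⟨K, _, _, F, _, _, _, _, f, hf, h₀, h₁, hi, hunr⟩ :=
    exists_belyiMap_signature_two_three_triple (m := m) (by omega)
  have hhyp : 3 * (3 * m) + 3 * m * 2 + 2 * 3 < 2 * 3 * (3 * m) := by ring_nf; omega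
  exact finite_properSolutions_of_belyiMap_of_faltings hhyp hf h₀ h₁ hi hunr hFaltings hA hB hC

/-- **`A x^r + B y² = C z³` has finitely many proper solutions for every `r ≥ 9` divisible by `3`,
modulo Faltings' theorem only.** [cite: DarmonGranville1995, Theorem 2 (p. 515)] -/
theorem finite_properSolutions_signature_triple_two_three_of_faltings {r : ℕ} (hr : 9 ≤ r) (h3 : 3 ∣ r)
    (hFaltings : ∀ (K' : Type) [Field K'] (F' : Type) [Field F'] [Algebra K' F'],
      finite_ratPlaces_of_two_le_genus K' F')
    {A B C : ℤ} (hA : A ≠ 0) (hB : B ≠ 0) (hC : C ≠ 0) :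
    {t : ℤ × ℤ × ℤ | ({t.1, t.2.1, t.2.2} : Finset ℤ).gcd id = 1 ∧
      A * t.1 ^ r + B * t.2.1 ^ 2 = C * t.2.2 ^ 3}.Finite := by
  obtain ⟨m, rfl⟩ := h3
  have h23 : ∀ A B C : ℤ, A ≠ 0 → B ≠ 0 → C ≠ 0 →
      {t : ℤ × ℤ × ℤ | ({t.1, t.2.1, t.2.2} : Finset ℤ).gcd id = 1 ∧
        A * t.1 ^ 2 + B * t.2.1 ^ 3 = C * t.2.2 ^ (3 * m)}.Finite := fun A B C hA hB hC =>
    finite_properSolutions_signature_two_three_triple_of_faltings (by omega) hFaltings hA hB hC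
  exact forall_finite_properSolutions_swap₁₂ (forall_finite_properSolutions_swap₂₃ h23) A B C hA hB hC

/-- **`A x^r + B y² = C z³` has finitely many proper solutions for every `r ≥ 8` not prime to `6`
(`2 ∣ r` or `3 ∣ r`), modulo Faltings' theorem only** — the union of the dihedral
(`finite_properSolutions_signature_even_two_three_of_faltings`) and tetrahedral constructions. The
remaining `r` (`gcd(r, 6) = 1`) have a perfect triangle group `Δ(2, 3, r)` and no Kummer tower.
[cite: DarmonGranville1995, Theorem 2 (p. 515)] -/
theorem finite_properSolutions_signature_r_two_three_of_faltings {r : ℕ} (hr : 8 ≤ r)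
    (h23 : 2 ∣ r ∨ 3 ∣ r)
    (hFaltings : ∀ (K' : Type) [Field K'] (F' : Type) [Field F'] [Algebra K' F'],
      finite_ratPlaces_of_two_le_genus K' F')
    {A B C : ℤ} (hA : A ≠ 0) (hB : B ≠ 0) (hC : C ≠ 0) :
    {t : ℤ × ℤ × ℤ | ({t.1, t.2.1, t.2.2} : Finset ℤ).gcd id = 1 ∧
      A * t.1 ^ r + B * t.2.1 ^ 2 = C * t.2.2 ^ 3}.Finite := by
  rcases h23 with h2 | h3
  · exact finite_properSolutions_signature_even_two_three_of_faltings hr h2 hFaltings hA hB hC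
  · by_cases h2 : 2 ∣ r
    · exact finite_properSolutions_signature_even_two_three_of_faltings hr h2 hFaltings hA hB hC
    · exact finite_properSolutions_signature_triple_two_three_of_faltings (by omega) h3 hFaltings hA hB hC

end DarmonGranville

end Literature.NumberTheory.DiophantineGeometry
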